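import Literature.AlgebraicGeometry.Morphisms.ExtensionMorphism
import HarnessLib

/-!
# Step (iii) of the dévissage: the morphism `𝒥₂𝒪_Z → M` is a monomorphism for a torsion-free section

For the morphism `φ : 𝒥₂𝒪_Z → M` of `Morphisms/ExtensionMorphism` ("`h ↦ h · s`") we prove that
`φ` is a monomorphism as soon as the section `s` is TORSION-FREE over `Z` — `c · s|_{V'} = 0` forces
`c|_Z = 0` for affine `V' ⊆ D(b₀)` — and `D(b₀)` meets the integral `Z` (`mono_extHom`): on a basis
open, `φ(k) = 0` makes the lift `ã` of `k` vanish on `Z ∩ D(g)` for all `g ∈ 𝓘`, i.e. on the dense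
open `Z ∩ D(b₀)` of `Z`, hence `ã|_Z = 0` (Mathlib `map_injective_of_isIntegral`). We also supply the
torsion-freeness from module-theoretic data on one affine `W` meeting `Z` (`app_eq_zero_of_smul_eq_zero`:
if `x₁ ∈ Γ(W, M)` has annihilator inside the prime `𝒥(W)`, then `x₁` is torsion-free over `Z` on every
affine `V' ⊆ W`), and `𝒥(W)` is prime (`isPrime_ideal`). This is the injectivity of
`u : 𝓕 → 𝒢` at the generic point in Görtz–Wedhorn I, Lemma 12.63 (iii).

Everything is proved; no named facts.

## References

* U. Görtz, T. Wedhorn, *Algebraic Geometry I*, 2nd ed. (2020): Lemma 12.63 (iii), p. 437. [GortzWedhorn2020]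
-/

noncomputable section

open CategoryTheory CategoryTheory.Limits AlgebraicGeometry TopologicalSpace Opposite
open Literature.AlgebraicGeometry.Modules

universe u

namespace Literature.AlgebraicGeometry.Morphisms

variable {X : Scheme.{u}}

/-- Sections of `𝒪_Z` over an empty open vanish. [folklore] -/
theorem app_eq_zero_of_isEmpty (J : X.IdealSheafData) {U : X.Opens} (h : ¬ Nonempty (J.subschemeι ⁻¹ᵁ U))
    (z : Γ(J.subscheme, J.subschemeι ⁻¹ᵁ U)) : z = 0 := by
  have hbot : J.subschemeι ⁻¹ᵁ U = ⊥ := by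
    ext x
    simp only [Opens.coe_bot, Set.mem_empty_iff_false, iff_false]
    exact fun hx => h ⟨⟨x, hx⟩⟩
  haveI : Subsingleton Γ(J.subscheme, J.subschemeι ⁻¹ᵁ U) :=
    CommRingCat.subsingleton_of_isTerminal (J.subscheme.sheaf.isTerminalOfEqEmpty hbot)
  exact Subsingleton.elim _ _

/-- **`𝒥(W)` is prime** for an affine `W` meeting the integral `Z = V(𝒥)`. [folklore] -/
theorem isPrime_ideal (J : X.IdealSheafData) [IsIntegral J.subscheme] {W : X.Opens} (hW : IsAffineOpen W)
    (hWZ : Nonempty (J.subschemeι ⁻¹ᵁ W)) : (J.ideal ⟨W, hW⟩).IsPrime := by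
  rw [← Scheme.IdealSheafData.ker_subschemeι_app J ⟨W, hW⟩]
  exact RingHom.ker_isPrime _

/-- If `h ∈ Γ(W, 𝒪_X)` vanishes on `Z`, then `Z ∩ D(h)` carries no non-zero functions. [folklore] -/
theorem app_basicOpen_eq_zero_of_mem (J : X.IdealSheafData) {W : X.Opens} (hW : IsAffineOpen W)
    {h : Γ(X, W)} (hh : h ∈ J.ideal ⟨W, hW⟩) (z : Γ(J.subscheme, J.subschemeι ⁻¹ᵁ X.basicOpen h)) :
    z = 0 := by
  have hu : IsUnit (X.presheaf.map (homOfLE (X.basicOpen_le h)).op h) := X.toRingedSpace.isUnit_res_basicOpen h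
  have hu' := hu.map (J.subschemeι.app (X.basicOpen h)).hom
  have h0 : J.subschemeι.app (X.basicOpen h) (X.presheaf.map (homOfLE (X.basicOpen_le h)).op h) = 0 := by
    have := ConcreteCategory.congr_hom (J.subschemeι.naturality (homOfLE (X.basicOpen_le h)).op) h
    change (X.presheaf.map _ ≫ J.subschemeι.app _) h = 0
    rw [this]
    change J.subscheme.presheaf.map _ (J.subschemeι.app W h) = 0
    rw [subschemeι_app_eq_zero J hh, map_zero]
  rw [h0] at hu'
  haveI := subsingleton_of_zero_eq_one (isUnit_zero_iff.mp hu')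
  exact Subsingleton.elim _ _

/-- **Torsion-freeness of a section from its annihilator on one affine.** If `x₁ ∈ Γ(W, M)` (`W`
affine, `M` affine-localizing) has `ann(x₁) ⊆ 𝒥(W)` with `𝒥(W)` prime, then for every affine `V' ⊆ W`
and `c ∈ Γ(V', 𝒪_X)` with `c · x₁|_{V'} = 0` we have `c|_Z = 0`. [cite: GortzWedhorn2020, Lemma 12.63 (iii)] -/
theorem app_eq_zero_of_smul_eq_zero (J : X.IdealSheafData) {M : X.Modules} (hM : IsAffineLocalizing M)
    {W : X.Opens} (hW : IsAffineOpen W) (hprime : (J.ideal ⟨W, hW⟩).IsPrime) (x₁ : Γ(M, W))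
    (hx₁ : ∀ d : Γ(X, W), d • x₁ = 0 → d ∈ J.ideal ⟨W, hW⟩) {V' : X.Opens} (hle : V' ≤ W) (c : Γ(X, V'))
    (hc : c • M.presheaf.map (homOfLE hle).op x₁ = 0) : J.subschemeι.app V' c = 0 := by
  -- check on the principal opens `D(h) ⊆ V'` of `W`
  let K : Type u := {h : Γ(X, W) // X.basicOpen h ≤ V'}
  have hcov : J.subschemeι ⁻¹ᵁ V' ≤ ⨆ k : K, J.subschemeι ⁻¹ᵁ X.basicOpen k.1 := by
    intro z hz
    obtain ⟨h, hhV, hzh⟩ := hW.exists_basicOpen_le (V := V') ⟨J.subschemeι.base z, hz⟩ (hle hz)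
    exact Opens.mem_iSup.mpr ⟨⟨h, hhV⟩, hzh⟩
  apply (J.subscheme.sheaf).eq_of_locally_eq' (fun k : K => J.subschemeι ⁻¹ᵁ X.basicOpen k.1)
    (J.subschemeι ⁻¹ᵁ V') (fun k => homOfLE (J.subschemeι.preimage_mono k.2)) hcov
  intro k
  obtain ⟨h, hhV⟩ := k
  change J.subscheme.presheaf.map (homOfLE (J.subschemeι.preimage_mono hhV)).op (J.subschemeι.app V' c) =
    J.subscheme.presheaf.map (homOfLE (J.subschemeι.preimage_mono hhV)).op 0
  rw [map_zero, show (homOfLE (J.subschemeι.preimage_mono hhV)).op =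
    ((Opens.map J.subschemeι.base).map (homOfLE hhV)).op from Subsingleton.elim _ _]
  suffices goal' : J.subschemeι.app (X.basicOpen h) (X.presheaf.map (homOfLE hhV).op c) = 0 from
    (ConcreteCategory.congr_hom (J.subschemeι.naturality (homOfLE hhV).op) c).symm.trans goal'
  -- `c| * h|^a = c''|` with `c'' ∈ Γ(W)`
  haveI := hW.isLocalization_basicOpen h
  obtain ⟨⟨c'', ⟨_, a, rfl⟩⟩, hc''⟩ := IsLocalization.surj (Submonoid.powers h)
    (X.presheaf.map (homOfLE hhV).op c : Γ(X, X.basicOpen h))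
  simp only [RingHom.algebraMap_toAlgebra] at hc''
  -- hc'' : c| * h|^a = c''|  (restrictions from `W`)
  change X.presheaf.map (homOfLE hhV).op c * X.presheaf.map (homOfLE (X.basicOpen_le h)).op (h ^ a) =
    X.presheaf.map (homOfLE (X.basicOpen_le h)).op c'' at hc''
  -- `c'' • x₁` vanishes on `D(h)`, so `h^L c'' x₁ = 0`
  have hv : M.presheaf.map (homOfLE (X.basicOpen_le h)).op (c'' • x₁) = 0 := by
    rw [Scheme.Modules.map_smul, ← hc'', mul_comm, mul_smul]
    have : X.presheaf.map (homOfLE hhV).op c • M.presheaf.map (homOfLE (X.basicOpen_le h)).op x₁ = 0 := by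
      have h2 := congrArg (M.presheaf.map (homOfLE hhV).op) hc
      rw [Scheme.Modules.map_smul, map_map, map_zero] at h2
      rw [map_eq_map M _ ((homOfLE hle).op ≫ (homOfLE hhV).op) x₁]
      exact h2
    rw [this, smul_zero]
  obtain ⟨L, hL⟩ := hM.torsion hW h (c'' • x₁) (X.basicOpen_le h) le_rfl hv
  rw [smul_smul] at hL
  have hmem := hx₁ _ hL
  rcases hprime.mem_or_mem hmem with hh | hc''J
  · exact app_basicOpen_eq_zero_of_mem J hW (hprime.mem_of_pow_mem L hh) _
  · -- `c''|_Z = 0` and `h|` is a unit on `D(h)`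
    have hu : IsUnit (J.subschemeι.app (X.basicOpen h)
        (X.presheaf.map (homOfLE (X.basicOpen_le h)).op (h ^ a))) := by
      rw [map_pow]
      exact ((X.toRingedSpace.isUnit_res_basicOpen h).pow a).map _
    have hc''0 : J.subschemeι.app (X.basicOpen h) (X.presheaf.map (homOfLE (X.basicOpen_le h)).op c'') = 0 := by
      have := ConcreteCategory.congr_hom (J.subschemeι.naturality (homOfLE (X.basicOpen_le h)).op) c''
      change (X.presheaf.map _ ≫ J.subschemeι.app _) c'' = 0
      rw [this]
      change J.subscheme.presheaf.map _ (J.subschemeι.app W c'') = 0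
      rw [subschemeι_app_eq_zero J hc''J, map_zero]
    have key := congrArg (J.subschemeι.app (X.basicOpen h)) hc''
    rw [map_mul, hc''0] at key
    exact (hu.mul_left_eq_zero).mp key

/-- **`φ : 𝒥₂𝒪_Z → M` is a monomorphism** when `s` is torsion-free over `Z` and `D(b₀)` meets the
integral `Z`. [cite: GortzWedhorn2020, Lemma 12.63 (iii) (p. 437)] -/
theorem ExtSetup.mono_extHom [IsLocallyNoetherian X] (D : ExtSetup X) [IsIntegral D.J.subscheme]
    (hbZ : Nonempty (D.J.subschemeι ⁻¹ᵁ X.basicOpen D.b₀))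
    (hTF : ∀ ⦃V' : X.Opens⦄ (_ : IsAffineOpen V') (hle : V' ≤ X.basicOpen D.b₀) (c : Γ(X, V')),
      c • D.M.presheaf.map (homOfLE hle).op D.s = 0 → D.J.subschemeι.app V' c = 0) :
    Mono D.extHom := by
  -- injectivity on the basis opens
  have hB : ∀ (p : D.ιB) (k : Γ(D.H, D.B p)), (D.extHom).app (D.B p) k = 0 → k = 0 := by
    intro p k hk
    rw [D.extHom_app_B] at hk
    have hx := D.isExtension_extB p k
    rw [hk] at hx
    -- the lift `ã` of `k` vanishes on `Z ∩ D(g)` for all `g ∈ 𝓘(D(h))`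
    have hg0 : ∀ (g : Γ(X, D.B p)), g ∈ (complIdeal D.b₀).ideal ⟨D.B p, D.isAffineOpen_B p⟩ →
        D.J.subschemeι.app (X.basicOpen g)
          (X.presheaf.map (homOfLE (X.basicOpen_le g)).op (D.lift (D.isAffineOpen_B p) k)) = 0 := by
      intro g hg
      have hgW := D.hIW₀ (D.isAffineOpen_B p) g hg
      refine hTF ((D.isAffineOpen_B p).basicOpen g) hgW _ ?_
      have := hx g hg hgW
      rw [map_zero] at this
      exact this.symm
    -- hence `ι^* ã` vanishes on the open `ι⁻¹(D(h) ∩ D(b₀))`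
    let O : D.J.subscheme.Opens := D.J.subschemeι ⁻¹ᵁ (D.B p ⊓ X.basicOpen D.b₀)
    have hO : O ≤ D.J.subschemeι ⁻¹ᵁ D.B p := D.J.subschemeι.preimage_mono inf_le_left
    have hvan : D.J.subscheme.presheaf.map (homOfLE hO).op
        (D.J.subschemeι.app (D.B p) (D.lift (D.isAffineOpen_B p) k)) = 0 := by
      let K : Type u := {g : Γ(X, D.B p) // g ∈ (complIdeal D.b₀).ideal ⟨D.B p, D.isAffineOpen_B p⟩}
      have hcov : O ≤ ⨆ q : K, D.J.subschemeι ⁻¹ᵁ X.basicOpen q.1 := by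
        intro z hz
        obtain ⟨g, hg, hzg⟩ := exists_mem_basicOpen_of_mem D.b₀ (D.isAffineOpen_B p) hz.1 hz.2
        exact Opens.mem_iSup.mpr ⟨⟨g, hg⟩, hzg⟩
      apply (D.J.subscheme.sheaf).eq_of_locally_eq' (fun q : K => D.J.subschemeι ⁻¹ᵁ X.basicOpen q.1) O
        (fun q => homOfLE (D.J.subschemeι.preimage_mono
          (le_inf (X.basicOpen_le q.1) (D.hIW₀ (D.isAffineOpen_B p) q.1 q.2)))) hcov
      intro q
      change D.J.subscheme.presheaf.map _ (D.J.subscheme.presheaf.map _ _) = D.J.subscheme.presheaf.map _ 0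
      rw [map_zero, ← CategoryTheory.comp_apply, ← Functor.map_comp]
      have nat := (ConcreteCategory.congr_hom (D.J.subschemeι.naturality (homOfLE (X.basicOpen_le q.1)).op)
        (D.lift (D.isAffineOpen_B p) k)).symm
      -- nat : (ι.app ≫ Z.map) ã = (X.map ≫ ι.app) ã
      refine (congrArg (fun φ => D.J.subscheme.presheaf.map φ
        (D.J.subschemeι.app (D.B p) (D.lift (D.isAffineOpen_B p) k))) (Subsingleton.elim _ _)).trans
        (nat.trans (hg0 q.1 q.2))
    -- and on `ι⁻¹D(h)` by integrality (or emptiness)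
    have hlift0 : D.J.subschemeι.app (D.B p) (D.lift (D.isAffineOpen_B p) k) = 0 := by
      by_cases hne : Nonempty (D.J.subschemeι ⁻¹ᵁ D.B p)
      · haveI : Nonempty O := by
          obtain ⟨z, hz⟩ := nonempty_preirreducible_inter (D.J.subschemeι ⁻¹ᵁ D.B p).isOpen
            (D.J.subschemeι ⁻¹ᵁ X.basicOpen D.b₀).isOpen
            (let ⟨⟨z, hz⟩⟩ := hne; ⟨z, hz⟩) (let ⟨⟨z, hz⟩⟩ := hbZ; ⟨z, hz⟩)
          exact ⟨⟨z, hz⟩⟩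
        exact map_injective_of_isIntegral D.J.subscheme (homOfLE hO) (by rw [map_zero]; exact hvan)
      · exact app_eq_zero_of_isEmpty D.J hne _
    apply kernel_ι_app_injective
    rw [map_zero, ← D.lift_spec (D.isAffineOpen_B p) k]
    exact hlift0
  -- injectivity on all opens, by locality in `H`
  refine mono_of_app_injective _ fun V k k' hkk' => ?_
  rw [← sub_eq_zero] at hkk' ⊢
  rw [← map_sub] at hkk'
  set κ := k - k'
  let K : Type u := {p : D.ιB // D.B p ≤ V}
  have hcov : V ≤ ⨆ q : K, D.B q.1 := by
    intro x hx
    obtain ⟨V', ⟨p, rfl⟩, hxV', hV'V⟩ := Opens.isBasis_iff_nbhd.mp D.isBasis_B hx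
    exact Opens.mem_iSup.mpr ⟨⟨p, hV'V⟩, hxV'⟩
  refine (abSheafOf D.H).eq_of_locally_eq' (fun q : K => D.B q.1) V (fun q => homOfLE q.2) hcov κ 0 fun q => ?_
  rw [map_zero]
  refine hB q.1 _ ?_
  rw [← map_app, hkk', map_zero]

end Literature.AlgebraicGeometry.Morphisms

end
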